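import Literature.NumberTheory.EllipticCurves.KummerSelmerStructure
import Literature.NumberTheory.GaloisRepresentations.AbsGaloisGroupProofs
import HarnessLib

/-!
# The action of `Aut(K/ℚ)` on LOCAL Galois cohomology `H¹(K_v, E[n]) → H¹(K_{σv}, E[n])`,
# compatible with the global action `conjAct` and the localisation maps

Companion of `Literature/NumberTheory/EllipticCurves/SelmerGaloisAction.lean` (the global action
`conjAct W σ n` of `σ ∈ Aut(K/ℚ)` on `H¹(K, E[n])` for `E = W/ℚ`, and the transport
`conjAct_mem_selmerLocalKer_iff` of the Selmer LOCAL KERNELS inside `H¹(K, E[n])`). Here the action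
is built on the local cohomology groups themselves, on the restricted modules
`GaloisRep.restrictField E ((W⁄K).torsionGaloisModule n)` of the `GaloisRepresentations` library
(the groups `H¹(K_v, E[n]) = galoisCohomology (ρ.toLocal v) 1` on which Selmer structures
`DiscreteGaloisModule.SelmerStructure` and local Tate duality live): for a `σ`-semilinear ring
isomorphism `θ : E ≃+* E'` of `K`-fields (the Galois transport of completions
`K_v ≃+* K_{σ v}`, tree `galAdicCompletionEquiv`; Cassels–Fröhlich, Ch. VII (Tate) §1.1), a lift
`Θ : K̄_E ≃+* K̄_{E'}` of `θ` and a lift `τ` of `σ` to `K̄` ADAPTED to `Θ` and to the chosen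
embeddings `ι_E : K̄ → K̄_E`, `ι_{E'} : K̄ → K̄_{E'}` (`LiftsCommute τ Θ : Θ ∘ ι_E = ι_{E'} ∘ τ`; such a
lift exists, `exists_isLiftOfAut_liftsCommute`, by the uniqueness of the algebraic closure up to
`K`-isomorphism, tree `exists_absClosureEmbedding_comp_eq`), the compatible pair
`(g ↦ Θ⁻¹ g Θ : Γ_{E'} → Γ_E, P ↦ τ P : E[n] → E[n])` induces

* `localConjH1 W hτ hΘ hc n : H¹(Γ_E, E[n]) →+ H¹(Γ_{E'}, E[n])`, `[ψ] ↦ [g ↦ τ ψ(Θ⁻¹ g Θ)]`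
  (Mathlib `ContinuousCohomology.map`; cocycle formula `localConjH1_oneCocycleClass`), with
* `localConjH1_res` — **compatibility with localisation**: `σ_{*,loc} ∘ res_E = res_{E'} ∘ σ_*`
  (`galoisCohomology.res`, `conjAct`), i.e. `loc_{σv}(σ_* s) = σ_* loc_v(s)`;
* `localConjH1_localConjH1` — **round trip**: along `E → E' → E` with `θ' ∘ θ = id` the two local
  actions compose to the identity of `H¹(Γ_E, E[n])` (the composite pair is the inner pair of
  `δ = Θ'Θ ∈ Γ_E`, and inner automorphisms act trivially on `H¹`: the composite cocycle differs
  from `ψ` by the coboundary of `ψ(δ)` — Serre, *Corps locaux*, VII.§5, Prop. 3);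
* `localConjH1_mem_kummerLocalConditionAt` — **transport of the Kummer local condition**
  `ker (H¹(Γ_E, E[n]) → H¹(Γ_E, E(K̄_E)))` (tree `kummerLocalConditionAt`, the local condition of the
  Selmer structure `kummerSelmerStructure`) at `E` into the one at `E'`.

These are the Galois-side inputs («`τ` on `⊕_v H¹(K_v, E[p^m])` permuting `v ↔ v̄`, `localization`
`τ`-equivariant, local conditions `τ`-stable») of the sign-by-sign form of Poitou–Tate duality used
by Jetchev 2008, §5 (Thm. 5.1 on the `±`-eigenspaces of complex conjugation) and by Gross 1991, §§5,
8 («`Sel(E/K)_p^± ⊂ H¹(K, E_p)^±`», classes tested in `H¹(K_λ, E_p)^±`). Everything here is PROVED;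
there are no named facts.

## Design notes

* Same generality and conventions as `SelmerGaloisAction.lean`: `W/ℚ`, `K` a field of
  characteristic `0`, `K`-fields `E`, `E'` in the universe of `K`; lifts are hypotheses
  (`IsLiftOfAut`, `IsLiftOfRingEquiv`, `LiftsCommute`), the maps depend on them only through the
  compatible pair. The embeddings `K̄ → K̄_E` are the FIXED ones of the two libraries
  (`closureEmb E = absClosureEmbedding K E`, `resGal E = absGaloisRestrict K E`, both `rfl`,
  `GeomPointsGaloisModule.lean`), which is why the lift `τ` (not the embedding) is adapted.
* No instance, no notation; definitions `LiftsCommute`, `localConjHom`, `localConjH1` only.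
* Not here: the choice of data at the finite places of a number field (`θ = galAdicCompletionEquiv`)
  and the sum over places — Summits-side consumers (`Rank1ResidualJetPairingCountingPermutation`).

## References

* J. W. S. Cassels, A. Fröhlich (eds.), *Algebraic Number Theory* (1967), Ch. VII (J. Tate), §1.1
  (action of the Galois group on primes and completions). [CasselsFrohlichANT1967]
* J.-P. Serre, *Local Fields*, GTM 67 (1979), VII.§5, Prop. 3; *Galois Cohomology* (1997), I.§2.4
  (compatible pairs), II.§1.1. [SerreLocalFields1979] [SerreGaloisCohomology1997]
* B. H. Gross, *Kolyvagin's work on modular elliptic curves*, LMS Lecture Note Ser. 153 (1991),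
  §5 (5.1), Props. 8.2, 9.6. [GrossLMS1991]
* D. Jetchev, *Global divisibility of Heegner points and Tamagawa numbers*, Compos. Math. 144
  (2008), §5, Thm. 5.1. [Jetchev2008]
-/

noncomputable section

open scoped Classical
open WeierstrassCurve Field
open Literature.NumberTheory.GaloisRepresentations

universe u

namespace Literature.NumberTheory.EllipticCurves

section Local

variable {K : Type u} [Field K] [CharZero K] (W : WeierstrassCurve ℚ)
variable {E E' : Type u} [Field E] [Algebra K E] [Field E'] [Algebra K E']
variable {σ : K ≃ₐ[ℚ] K} {τ : AlgebraicClosure K ≃+* AlgebraicClosure K} {θ : E ≃+* E'}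
  {Θ : AlgebraicClosure E ≃+* AlgebraicClosure E'}

/-! ### Lifts adapted to the chosen embeddings -/

/-- A lift `τ` of `σ` to `K̄` and a lift `Θ : K̄_E ≃+* K̄_{E'}` of `θ : E ≃+* E'` **commute with the
chosen embeddings** `ι_E : K̄ → K̄_E`, `ι_{E'} : K̄ → K̄_{E'}` (`absClosureEmbedding`): `Θ ∘ ι_E = ι_{E'} ∘ τ`.
For such a pair `(Θ⁻¹(·)Θ, τ)` is a compatible pair for the RESTRICTED modules `E[n]|_{Γ_E}`,
`E[n]|_{Γ_{E'}}` (`absGaloisRestrict_conjGalCMH`). [cite: SerreGaloisCohomology1997, II.§1.1 (choice of the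
embedding `k̄ → k̄_v`, decomposition groups defined up to conjugacy)] -/
def LiftsCommute (τ : AlgebraicClosure K ≃+* AlgebraicClosure K)
    (Θ : AlgebraicClosure E ≃+* AlgebraicClosure E') : Prop :=
  ∀ x, Θ (absClosureEmbedding K E x) = absClosureEmbedding K E' (τ x)

/-- **Adapted lifts exist**: for `σ`-semilinear `θ : E ≃+* E'` and any lift `Θ` of `θ`, some lift `τ`
of `σ` satisfies `Θ ∘ ι_E = ι_{E'} ∘ τ`. Proof: for an arbitrary lift `τ₀` (`liftAut σ`) the map
`ι' = Θ ∘ ι_E ∘ τ₀⁻¹` is a `K`-embedding `K̄ → K̄_{E'}` (tree `embOfLifts`), hence `ι' = ι_{E'} ∘ γ` for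
some `γ ∈ Γ_K` (uniqueness of the algebraic closure up to `K`-isomorphism, tree
`exists_absClosureEmbedding_comp_eq`); take `τ = γ ∘ τ₀`.
[cite: MilneFT2022, Ch. 6 Thm 6.8 & Rmk 6.9 (v4.60 numbering)] -/
theorem exists_isLiftOfAut_liftsCommute (σ : K ≃ₐ[ℚ] K) (hθ : IsSemilinearRingEquiv σ θ)
    (hΘ : IsLiftOfRingEquiv θ Θ) :
    ∃ τ : AlgebraicClosure K ≃+* AlgebraicClosure K, IsLiftOfAut σ τ ∧ LiftsCommute τ Θ := by
  have hτ₀ : IsLiftOfAut σ (liftAut σ) := isLiftOfAut_liftAut σ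
  obtain ⟨γ, hγ⟩ := exists_absClosureEmbedding_comp_eq K E' (embOfLifts hτ₀ hθ hΘ)
  refine ⟨(liftAut σ).trans (absoluteGaloisGroup.toAlgEquiv K γ).toRingEquiv, fun x => ?_,
    fun x => ?_⟩
  · rw [RingEquiv.trans_apply, hτ₀ x]
    exact (absoluteGaloisGroup.toAlgEquiv K γ).commutes (σ x)
  · rw [RingEquiv.trans_apply]
    change _ = absClosureEmbedding K E' (γ • liftAut σ x)
    rw [hγ, embOfLifts_apply, RingEquiv.symm_apply_apply]
    rfl

variable {W}

omit [CharZero K] in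
/-- Under `LiftsCommute τ Θ`: `ι_E (τ⁻¹ y) = Θ⁻¹ (ι_{E'} y)`.
[cite: SerreGaloisCohomology1997, II.§1.1] -/
theorem LiftsCommute.symm_apply (hc : LiftsCommute τ Θ) (y : AlgebraicClosure K) :
    absClosureEmbedding K E (τ.symm y) = Θ.symm (absClosureEmbedding K E' y) := by
  apply Θ.injective
  rw [hc, RingEquiv.apply_symm_apply, RingEquiv.apply_symm_apply]

/-- **The Galois sides match**: for adapted lifts, restricting `Θ⁻¹ g Θ ∈ Γ_E` to `K̄` along `ι_E`
gives `τ⁻¹ (g|_{K̄}) τ`, the restriction of `g ∈ Γ_{E'}` along `ι_{E'}` conjugated by `τ`: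
`res_E (Θ⁻¹ g Θ) = τ⁻¹ (res_{E'} g) τ` (both are `x ↦ (Θ ι_E)⁻¹ g (Θ ι_E) x`).
[cite: SerreGaloisCohomology1997, II.§1.1 and I.§2.4 (compatible pairs)] -/
theorem LiftsCommute.absGaloisRestrict_conjGalCMH (hτ : IsLiftOfAut σ τ)
    (hΘ : IsLiftOfRingEquiv θ Θ) (hc : LiftsCommute τ Θ) (g : absoluteGaloisGroup E') :
    absGaloisRestrict K E (hΘ.conjGalCMH g) = hτ.conjGalCMH (absGaloisRestrict K E' g) := by
  apply (MulAction.toPerm_injective (α := absoluteGaloisGroup K) (β := AlgebraicClosure K))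
  ext x
  change absGaloisRestrict K E (hΘ.conjGalCMH g) • x = hτ.conjGalCMH (absGaloisRestrict K E' g) • x
  have h1 : absClosureEmbedding K E (absGaloisRestrict K E (hΘ.conjGalCMH g) • x) =
      absClosureEmbedding K E (hτ.conjGalCMH (absGaloisRestrict K E' g) • x) := by
    rw [absGaloisRestrict_apply_smul]
    change Θ.symm ((show AlgebraicClosure E' ≃ₐ[E'] AlgebraicClosure E' from g)
        (Θ (absClosureEmbedding K E x))) =
      absClosureEmbedding K E (τ.symm ((show AlgebraicClosure K ≃ₐ[K] AlgebraicClosure K from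
        absGaloisRestrict K E' g) (τ x)))
    rw [hc.symm_apply, hc]
    congr 1
    exact (absGaloisRestrict_apply_smul K E' g (τ x)).symm
  exact (absClosureEmbedding K E).toRingHom.injective h1

/-! ### The local action -/

variable (W)

/-- The morphism of topological `Γ_{E'}`-representations `res_{Θ⁻¹(·)Θ} (E[n]|_{Γ_E}) ⟶ E[n]|_{Γ_{E'}}`
given by `P ↦ τ P` (`IsLiftOfAut.torsionMap`) for adapted lifts: the compatible pair defining the
local action. [cite: SerreGaloisCohomology1997, I.§2.4 (compatible pairs)] -/
def localConjHom (hτ : IsLiftOfAut σ τ) (hΘ : IsLiftOfRingEquiv θ Θ) (hc : LiftsCommute τ Θ)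
    (n : ℤ) :
    TopRep.res (hΘ.conjGalCMH : absoluteGaloisGroup E' →* absoluteGaloisGroup E)
        (DiscreteGaloisModule.toTopRep
          (GaloisRep.restrictField E ((W.baseChange K).torsionGaloisModule n))) ⟶
      DiscreteGaloisModule.toTopRep
        (GaloisRep.restrictField E' ((W.baseChange K).torsionGaloisModule n)) :=
  TopRep.ofHom
    { toContinuousLinearMap :=
        ⟨(hτ.torsionMap W n).toIntLinearMap, continuous_of_discreteTopology⟩
      isIntertwining' := fun g => by
        refine ContinuousLinearMap.ext fun P => ?_
        change hτ.torsionMap W n (absGaloisRestrict K E (hΘ.conjGalCMH g) • P) =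
          absGaloisRestrict K E' g • hτ.torsionMap W n P
        rw [hc.absGaloisRestrict_conjGalCMH hτ hΘ, hτ.torsionMap_smul] }

/-- Unfolding `localConjHom`: it is `P ↦ τ P` on `E[n]`.
[cite: SerreGaloisCohomology1997, I.§2.4 (compatible pairs)] -/
theorem localConjHom_hom_apply (hτ : IsLiftOfAut σ τ) (hΘ : IsLiftOfRingEquiv θ Θ)
    (hc : LiftsCommute τ Θ) (n : ℤ) (P : geomTorsion (W.baseChange K) n) :
    (localConjHom W hτ hΘ hc n).hom P = hτ.torsionMap W n P := rfl

/-- **The action of `σ ∈ Aut(K/ℚ)` on local cohomology**, `H¹(Γ_E, E[n]) →+ H¹(Γ_{E'}, E[n])` for a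
`σ`-semilinear `θ : E ≃+* E'` with adapted lifts `(τ, Θ)`: `[ψ] ↦ [g ↦ τ ψ(Θ⁻¹ g Θ)]` (Mathlib
`ContinuousCohomology.map` along the compatible pair `localConjHom`). For `E = K_v`, `E' = K_{σ v}`,
`θ` the Galois transport of completions, this is `σ_* : H¹(K_v, E[n]) → H¹(K_{σv}, E[n])`
(Cassels–Fröhlich VII §1.1; Gross 1991 §§5, 8: classes of `H¹(K, E_p)^±` tested in `H¹(K_λ, E_p)`).
[cite: CasselsFrohlichANT1967, Ch. VII §1.1] -/
def localConjH1 (hτ : IsLiftOfAut σ τ) (hΘ : IsLiftOfRingEquiv θ Θ) (hc : LiftsCommute τ Θ)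
    (n : ℤ) :
    galoisCohomology (GaloisRep.restrictField E ((W.baseChange K).torsionGaloisModule n)) 1 →+
      galoisCohomology (GaloisRep.restrictField E' ((W.baseChange K).torsionGaloisModule n)) 1 :=
  (ContinuousCohomology.map hΘ.conjGalCMH (localConjHom W hτ hΘ hc n) 1).hom.toLinearMap.toAddMonoidHom

/-- `localConjH1` on the class of a continuous crossed homomorphism `ψ : Γ_E → E[n]`:
`[ψ] ↦ [g ↦ τ ψ(Θ⁻¹ g Θ)]`. [cite: SerreGaloisCohomology1997, I.§2.4 (the map on cochains
`f ↦ (g ↦ ψ f(φ g))` induced by a compatible pair)] -/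
theorem localConjH1_oneCocycleClass (hτ : IsLiftOfAut σ τ) (hΘ : IsLiftOfRingEquiv θ Θ)
    (hc : LiftsCommute τ Θ) (n : ℤ)
    (ψ : contOneCocycles (DiscreteGaloisModule.toTopRep
      (GaloisRep.restrictField E ((W.baseChange K).torsionGaloisModule n)))) :
    localConjH1 W hτ hΘ hc n (oneCocycleClass _ ψ) =
      oneCocycleClass _ (contOneCocycles.pullback hΘ.conjGalCMH (localConjHom W hτ hΘ hc n) ψ) :=
  map_oneCocycleClass _ _ _ ψ

/-! ### Compatibility with localisation -/

/-- **`σ_{*,loc} ∘ res_E = res_{E'} ∘ σ_*`**: the local action intertwines the localisation maps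
`res_E : H¹(K, E[n]) → H¹(Γ_E, E[n])`, `res_{E'}` (`galoisCohomology.res`) and the global action
`conjAct W σ n` — both composites are induced by the compatible pair
`(g ↦ res_E (Θ⁻¹ g Θ) = τ⁻¹ res_{E'}(g) τ, P ↦ τ P)` (`absGaloisRestrict_conjGalCMH`). In the
number-field case: `loc_{σ v} (σ_* s) = σ_* (loc_v s)`, the `τ`-equivariance of localisation used in
Jetchev 2008 Thm. 5.1 / Gross 1991 Prop. 8.2. [cite: Jetchev2008, §5 Thm. 5.1]
[cite: GrossLMS1991, §5 (5.1), Prop. 8.2] -/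
theorem localConjH1_res (hτ : IsLiftOfAut σ τ) (hΘ : IsLiftOfRingEquiv θ Θ)
    (hc : LiftsCommute τ Θ) (n : ℤ) (s : galH1Torsion (W.baseChange K) n) :
    localConjH1 W hτ hΘ hc n
        (galoisCohomology.res ((W.baseChange K).torsionGaloisModule n) E 1 s) =
      galoisCohomology.res ((W.baseChange K).torsionGaloisModule n) E' 1 (conjAct W σ n s) := by
  obtain ⟨φ, rfl⟩ := oneCocycleClass_surjective
    (discreteTopRep (absoluteGaloisGroup K) (geomTorsion (W.baseChange K) n)) s
  rw [← hτ.conjH1_eq_conjAct W n, (W.baseChange K).res_torsionGaloisModule_oneCocycleClass n E φ,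
    localConjH1_oneCocycleClass]
  have h1 : hτ.conjH1 W n (oneCocycleClass _ φ) = oneCocycleClass _
      (contOneCocycles.pullback hτ.conjGalCMH (resHomOfEquivariant hτ.conjGalCMH
        (hτ.torsionMap W n) (hτ.torsionMap_smul W n)) φ) :=
    map_oneCocycleClass _ _ _ φ
  rw [h1, (W.baseChange K).res_torsionGaloisModule_oneCocycleClass n E']
  congr 1
  apply Subtype.ext
  apply ContinuousMap.ext
  intro g
  rw [contOneCocycles.pullback_apply, contOneCocycles.pullback_apply,
    contOneCocycles.pullback_apply, contOneCocycles.pullback_apply]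
  change hτ.torsionMap W n (φ.1 (absGaloisRestrict K E (hΘ.conjGalCMH g))) =
    hτ.torsionMap W n (φ.1 (hτ.conjGalCMH (absGaloisRestrict K E' g)))
  rw [hc.absGaloisRestrict_conjGalCMH hτ hΘ]

/-! ### Round trip -/

section RoundTrip

variable {σ' : K ≃ₐ[ℚ] K} {τ₂ : AlgebraicClosure K ≃+* AlgebraicClosure K} {θ' : E' ≃+* E}
  {Θ' : AlgebraicClosure E' ≃+* AlgebraicClosure E}

/-- The element `δ = Θ'Θ ∈ Γ_E` when `θ' ∘ θ = id_E` (as a `E`-algebra automorphism of `K̄_E`).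
Auxiliary (statement-level data are avoided: it only appears inside proofs).
[cite: SerreGaloisCohomology1997, II.§1.1] -/
theorem exists_absoluteGaloisGroup_smul_eq (hΘ : IsLiftOfRingEquiv θ Θ)
    (hΘ' : IsLiftOfRingEquiv θ' Θ') (hθθ' : ∀ x, θ' (θ x) = x) :
    ∃ δ : absoluteGaloisGroup E, ∀ y : AlgebraicClosure E, δ • y = Θ' (Θ y) := by
  refine ⟨(absoluteGaloisGroup.toAlgEquiv E).symm
    { Θ.trans Θ' with
      commutes' := fun e => by
        change Θ' (Θ (algebraMap E (AlgebraicClosure E) e)) = algebraMap E (AlgebraicClosure E) e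
        rw [hΘ, hΘ', hθθ'] }, fun y => rfl⟩

omit [CharZero K] in
/-- For adapted lifts along `E → E' → E` with `θ' ∘ θ = id`: `τ₂ (τ x) = res_E(δ) • x` with
`δ = Θ'Θ ∈ Γ_E` (apply `ι_E` and use `Θ ι_E = ι_{E'} τ`, `Θ' ι_{E'} = ι_E τ₂`).
[cite: SerreGaloisCohomology1997, II.§1.1] -/
theorem LiftsCommute.comp_apply_eq_smul (hc : LiftsCommute τ Θ) (hc' : LiftsCommute τ₂ Θ')
    {δ : absoluteGaloisGroup E} (hδ : ∀ y : AlgebraicClosure E, δ • y = Θ' (Θ y))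
    (x : AlgebraicClosure K) : τ₂ (τ x) = absGaloisRestrict K E δ • x := by
  have h1 : absClosureEmbedding K E (τ₂ (τ x)) =
      absClosureEmbedding K E (absGaloisRestrict K E δ • x) := by
    rw [absGaloisRestrict_apply_smul, hδ, hc, hc']
  exact (absClosureEmbedding K E).toRingHom.injective h1

/-- **Round trip**: along `E →θ E' →θ' E` with `θ' ∘ θ = id_E`, and adapted lifts `(τ, Θ)` of
`(σ, θ)`, `(τ₂, Θ')` of `(σ', θ')`, the local actions compose to the identity of `H¹(Γ_E, E[n])`.
The composite compatible pair is the INNER pair `(g ↦ δ⁻¹ g δ, P ↦ δ P)` of `δ = Θ'Θ ∈ Γ_E`, and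
the composite cocycle `g ↦ δ ψ(δ⁻¹ g δ) = ψ g + (g ψ(δ) − ψ(δ))` differs from `ψ` by a coboundary
(Serre, *Corps locaux*, VII.§5, Prop. 3: inner automorphisms act trivially on cohomology). With
`E = K_v`, `E' = K_{σ v}`, `σ² = 1`: `σ_* ∘ σ_* = id` on `H¹(K_v, E[n])`.
[cite: SerreLocalFields1979, VII.§5 Prop. 3] -/
theorem localConjH1_localConjH1 (hτ : IsLiftOfAut σ τ) (hΘ : IsLiftOfRingEquiv θ Θ)
    (hc : LiftsCommute τ Θ) (hτ₂ : IsLiftOfAut σ' τ₂) (hΘ' : IsLiftOfRingEquiv θ' Θ')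
    (hc' : LiftsCommute τ₂ Θ') (hθθ' : ∀ x, θ' (θ x) = x) (n : ℤ)
    (c : galoisCohomology (GaloisRep.restrictField E ((W.baseChange K).torsionGaloisModule n)) 1) :
    localConjH1 W hτ₂ hΘ' hc' n (localConjH1 W hτ hΘ hc n c) = c := by
  obtain ⟨δ, hδ⟩ := exists_absoluteGaloisGroup_smul_eq hΘ hΘ' hθθ'
  obtain ⟨ψ, rfl⟩ := oneCocycleClass_surjective (DiscreteGaloisModule.toTopRep
    (GaloisRep.restrictField E ((W.baseChange K).torsionGaloisModule n))) c
  rw [localConjH1_oneCocycleClass, localConjH1_oneCocycleClass]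
  -- the Galois side of the composite pair is conjugation by `δ`
  have hgal : ∀ g : absoluteGaloisGroup E,
      hΘ.conjGalCMH (hΘ'.conjGalCMH g) = δ⁻¹ * (g * δ) := by
    intro g
    apply (MulAction.toPerm_injective (α := absoluteGaloisGroup E) (β := AlgebraicClosure E))
    ext y
    change hΘ.conjGalCMH (hΘ'.conjGalCMH g) • y = (δ⁻¹ * (g * δ)) • y
    rw [mul_smul, mul_smul, hδ, eq_inv_smul_iff, hδ]
    change Θ' (Θ (Θ.symm (Θ'.symm ((show AlgebraicClosure E ≃ₐ[E] AlgebraicClosure E from g)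
      (Θ' (Θ y)))))) = _
    rw [RingEquiv.apply_symm_apply, RingEquiv.apply_symm_apply]
    rfl
  -- the coefficient side of the composite pair is the action of `res_E δ`
  have hcoef : ∀ P : geomTorsion (W.baseChange K) n,
      hτ₂.torsionMap W n (hτ.torsionMap W n P) = absGaloisRestrict K E δ • P := by
    intro P
    apply Subtype.ext
    change hτ₂.pointsMap W (hτ.pointsMap W P) = absGaloisRestrict K E δ • (P : geomPoints _)
    generalize (P : geomPoints (W.baseChange K)) = R
    change ((W.baseChange K).baseChange (AlgebraicClosure K)).toAffine.Point at R
    rcases R with _ | ⟨x, y, h⟩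
    · rfl
    · -- both sides are `Point.map` of an affine point: compare coordinates
      exact Affine.Point.some_eq_some_of_eq (hc.comp_apply_eq_smul hc' hδ x)
        (hc.comp_apply_eq_smul hc' hδ y)
  -- the composite cocycle differs from `ψ` by the coboundary of `ψ δ`
  suffices h : oneCocycleClass _ (contOneCocycles.pullback hΘ'.conjGalCMH
      (localConjHom W hτ₂ hΘ' hc' n)
      (contOneCocycles.pullback hΘ.conjGalCMH (localConjHom W hτ hΘ hc n) ψ) - ψ) = 0 by
    rwa [oneCocycleClass_sub, sub_eq_zero] at h
  refine (oneCocycleClass_eq_zero_iff _ _).mpr ⟨ψ.1 δ, fun g => ?_⟩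
  rw [Submodule.coe_sub, ContinuousMap.sub_apply, contOneCocycles.pullback_apply,
    contOneCocycles.pullback_apply]
  change hτ₂.torsionMap W n (hτ.torsionMap W n (ψ.1 (hΘ.conjGalCMH (hΘ'.conjGalCMH g)))) -
    ψ.1 g = _
  rw [hcoef, hgal]
  change (DiscreteGaloisModule.toTopRep
      (GaloisRep.restrictField E ((W.baseChange K).torsionGaloisModule n))).ρ δ
        (ψ.1 (δ⁻¹ * (g * δ))) - ψ.1 g =
    (DiscreteGaloisModule.toTopRep
      (GaloisRep.restrictField E ((W.baseChange K).torsionGaloisModule n))).ρ g (ψ.1 δ) - ψ.1 δ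
  rw [contOneCocycles.apply_smul_inv_mul, ψ.2 g δ]
  abel

end RoundTrip

/-! ### Transport of the Kummer local condition -/

section Kummer

variable [CharZero E] [CharZero E']

/-- The coefficient sides of the Kummer squares agree for adapted lifts:
`Θ (ι_E P) = ι_{E'} (τ P)` on points, i.e. `localPointsMap Θ ∘ pointsMap_E = pointsMap_{E'} ∘ τ`.
[cite: SerreGaloisCohomology1997, I.§2.4 (compatible pairs)] [cite: SilvermanAEC2009, X.§4] -/
theorem LiftsCommute.localPointsMap_pointsMap (hτ : IsLiftOfAut σ τ) (hc : LiftsCommute τ Θ)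
    (P : geomPoints (W.baseChange K)) :
    localPointsMap W Θ (pointsMap (W.baseChange K) E P) =
      pointsMap (W.baseChange K) E' (hτ.pointsMap W P) := by
  change ((W.baseChange K).baseChange (AlgebraicClosure K)).toAffine.Point at P
  rcases P with _ | ⟨x, y, h⟩
  · exact (localPointsMap_zero W Θ).trans (map_zero _).symm
  · change localPointsMap W Θ (WeierstrassCurve.Affine.Point.map (W' := W.baseChange K)
        (closureEmb (K := K) E) (.some x y h)) = _
    rw [WeierstrassCurve.Affine.Point.map_some, localPointsMap_some]
    exact Affine.Point.some_eq_some_of_eq (hc x) (hc y)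

/-- **The local action carries the Kummer local condition at `E` into the one at `E'`**:
`σ_{*,loc} (ker (H¹(Γ_E, E[n]) → H¹(Γ_E, E(K̄_E)))) ⊆ ker (H¹(Γ_{E'}, E[n]) → H¹(Γ_{E'}, E(K̄_{E'})))`
(tree `kummerLocalConditionAt`, the local condition of `kummerSelmerStructure`): the square with the
map `H¹(Γ_E, E(K̄_E)) → H¹(Γ_{E'}, E(K̄_{E'}))` induced by `(Θ⁻¹(·)Θ, localPointsMap Θ)` commutes on
cocycles (`localPointsMap_pointsMap`). With `E = K_v`: `σ_*` maps the Kummer condition at `v` into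
the one at `σ v` — the local form of `conjAct_mem_selmerGroup` (Gross 1991 §5: `Sel(E/K)_p` is a
`Gal(K/ℚ)`-module). [cite: GrossLMS1991, §5 (5.1)] [cite: SilvermanAEC2009, X.§4] -/
theorem localConjH1_mem_kummerLocalConditionAt (hτ : IsLiftOfAut σ τ)
    (hΘ : IsLiftOfRingEquiv θ Θ) (hc : LiftsCommute τ Θ) (n : ℤ)
    {c : galoisCohomology (GaloisRep.restrictField E ((W.baseChange K).torsionGaloisModule n)) 1}
    (hcm : c ∈ (W.baseChange K).kummerLocalConditionAt n E) :
    localConjH1 W hτ hΘ hc n c ∈ (W.baseChange K).kummerLocalConditionAt n E' := by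
  obtain ⟨ψ, rfl⟩ := oneCocycleClass_surjective _ c
  rw [mem_kummerLocalConditionAt_iff, map_torsionPointsMapIntertwining_oneCocycleClass] at hcm
  obtain ⟨Q, hQ⟩ := (oneCocycleClass_eq_zero_iff _ _).mp hcm
  have hQ' : ∀ g : absoluteGaloisGroup E,
      pointsMap (W.baseChange K) E (ψ.1 g : geomTorsion (W.baseChange K) n) = g • Q - Q := hQ
  rw [mem_kummerLocalConditionAt_iff, localConjH1_oneCocycleClass,
    map_torsionPointsMapIntertwining_oneCocycleClass]
  refine (oneCocycleClass_eq_zero_iff _ _).mpr ⟨localPointsMap W Θ Q, fun g => ?_⟩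
  change pointsMap (W.baseChange K) E'
      (hτ.torsionMap W n (ψ.1 (hΘ.conjGalCMH g)) : geomTorsion (W.baseChange K) n) =
    g • localPointsMap W Θ Q - localPointsMap W Θ Q
  rw [IsLiftOfAut.coe_torsionMap, ← hc.localPointsMap_pointsMap W hτ, hQ', map_sub,
    hΘ.localPointsMap_smul]

end Kummer

end Local

end Literature.NumberTheory.EllipticCurves

end
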